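/-
Origin: expansion seat `prover-pub-hodgecm-mc-binder-1-g17-0`, handover #R116r2 2026-08-20T22:31:33Z md5 c68de6aa8948 (116 l.; REPLACE of HodgeCM/Model/HsmallOfTower.lean — PKG file now 3f1056a719a6 (120 l., incl. packager Origin header); body of record b6f5e01925d6 (116 l.) → c68de6aa8948; owner binder-1 #R116 (RUN 63); token strike only; NAMES for audit: HodgeCM.Model.hThetaUnion_of_tower · HodgeCM.Model.hsmall_of_tower) (`HOME/mc/pub-hodgecm-mc-binder-1-g17/campaign/new/HsmallOfTower.lean`, md5 c68de6aa8948, 116 lines);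
landed by the gen-27 packager (p-g27) in gate run 65 REPLACES the earlier landed copy of `HodgeCM/Model/HsmallOfTower.lean` (verbatim).
-/
/-
Copyright (c) 2026 the pub-hodgecm formalisation cell (harness21).  New file, not vendored.
Origin: session prover-pub-hodgecm-mc-binder-1-g16-0 (unit pub-hodgecm-mc-binder-1-g16, BINDER PROVER gen 16 of lineage mc-binder-1;
content lane (J-Liu-Θ), (J3) — E-shaped corollaries of the junction through the tower instance), 2026-08-20.
-/
import Summits.HodgeConjecture.HodgeCM.Model.HThetaOfTower

/-!
# E's `hΘ∪` / `hsmall` through the tower: the E-shaped corollaries over `LiuDictionary.ofTower`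

The analogues of axioms-1-g15's `hThetaUnion_of_liuDictionary` / `hsmall_of_liuDictionary` (RUN 62) with the dictionary BUILT as
`LiuDictionary.ofTower … V (Char V) (Adm V) (Ω V) (PhiMu V) (adm V)` for families of adèlic carriers and CM comprehensions over all
`(L, ι₁, V)`, and with the geometric half of `hIso` discharged (`subset_span_of_tower`): the last clause of `hJ` is now the (J4)
FAMILY input `hfam` at the levels of the tower.  `hsmall_of_tower`'s conclusion is the `hsmall` binder shape of E (union form, scoped by `P`).
-/

noncomputable section

open Function Set
open NumberField
open Literature.AlgebraicGeometry.Motives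
open Literature.AlgebraicGeometry.ShimuraVarieties
open Literature.AlgebraicGeometry.HodgeTheory
open Literature.NumberTheory.Automorphic
open Literature.NumberTheory.Automorphic.PicardCM
open Literature.NumberTheory.Transcendental (Arapura2012_Cor_15_4_6)

namespace HodgeCM.Model

open HodgeCM.Model.TowerLevel HodgeCM.Model.TowerCarrier HodgeCM.Literature.Theta HodgeCM.Literature.Theta.LiuAlbaneseModuleDatum
open HodgeCM.CMTypeOps (inflate)
open HodgeCM.Universe (ThetaModel)

variable {hHD : exists_isReal_hodgeModel} {hI : hodgePQ_independent_of_hodgeModel}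
  {h₁ : BallQuotientUniformised} {h₃ : CMAbelianVarietyRealised}

/-- **E's `hΘ∪` THROUGH THE TOWER.**  For families of adèlic carriers `Char, Adm, Ω, PhiMu` and CM comprehensions `adm` over all
`(L, ι₁, V)`: if the cited sentences hold for the tower dictionaries and in every scoped good sextic context each index `i` has a
finite set `S` of characters with `ι₁ ∈ Φ_μ`, corner-matched admissible CM data, and (J4) FAMILIES of component classes for the theta
classes at the tower's levels, then the hypothesis `hΘ` of `hsmall_of_commonReflexUnion_of … P` holds verbatim. -/
theorem hThetaUnion_of_tower (hA : Arapura2012_Cor_15_4_6)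
    (R : (picardCMUniverse hHD hI h₁ h₃).ThetaModel)
    (Char : ∀ {L : CMField} {ι₁ : L →+* ℂ}, HermSpace3 L ι₁ → Type)
    (Adm : ∀ {L : CMField} {ι₁ : L →+* ℂ} (V : HermSpace3 L ι₁), Char V → Type)
    (Ω : ∀ {L : CMField} {ι₁ : L →+* ℂ} (V : HermSpace3 L ι₁) (μ : Char V), Adm V μ → Type)
    [∀ {L : CMField} {ι₁ : L →+* ℂ} (V : HermSpace3 L ι₁) (μ : Char V) (a : Adm V μ), AddCommGroup (Ω V μ a)]
    [∀ {L : CMField} {ι₁ : L →+* ℂ} (V : HermSpace3 L ι₁) (μ : Char V) (a : Adm V μ), Module ℂ (Ω V μ a)]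
    [∀ {L : CMField} {ι₁ : L →+* ℂ} (V : HermSpace3 L ι₁) (μ : Char V) (a : Adm V μ), Module (adelicAlgebra V) (Ω V μ a)]
    [∀ {L : CMField} {ι₁ : L →+* ℂ} (V : HermSpace3 L ι₁) (μ : Char V) (a : Adm V μ), IsScalarTower ℂ (adelicAlgebra V) (Ω V μ a)]
    (PhiMu : ∀ {L : CMField} {ι₁ : L →+* ℂ} (V : HermSpace3 L ι₁), Char V → Prop)
    (adm : ∀ {L : CMField} {ι₁ : L →+* ℂ} (V : HermSpace3 L ι₁), Char V → LiuCMSide → Prop)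
    (hcite : ∀ {L : CMField} {ι₁ : L →+* ℂ} (V : HermSpace3 L ι₁),
      (LiuDictionary.ofTower hHD hI h₁ h₃ hA V (Char V) (Adm V) (Ω V) (PhiMu V) (adm V)).Irreducible ∧
      (LiuDictionary.ofTower hHD hI h₁ h₃ hA V (Char V) (Adm V) (Ω V) (PhiMu V) (adm V)).Prop413 ∧
      (LiuDictionary.ofTower hHD hI h₁ h₃ hA V (Char V) (Adm V) (Ω V) (PhiMu V) (adm V)).Thm418_2 ∧
      (LiuDictionary.ofTower hHD hI h₁ h₃ hA V (Char V) (Adm V) (Ω V) (PhiMu V) (adm V)).MuSeparated ∧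
      (LiuDictionary.ofTower hHD hI h₁ h₃ hA V (Char V) (Adm V) (Ω V) (PhiMu V) (adm V)).Thm418C)
    (P : ∀ {L : CMField} {ι₁ : L →+* ℂ}, HermSpace3 L ι₁ → SeesawCtx L → Prop)
    (hJ : ∀ {L : CMField} {ι₁ : L →+* ℂ} (V : HermSpace3 L ι₁) (c : SeesawCtx L), P V c → R.GoodCtx ι₁ c →
      Module.finrank ℚ c.K = 6 → ∀ i : Fin 4, ∃ S : Finset (Char V),
        (∀ μ ∈ S, PhiMu V μ) ∧
        (∀ μ ∈ S, ∀ d : LiuCMSide, adm V μ d → d.IsCorner c.K (c.Ψ i) c.σ) ∧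
        ∀ (Γ : Level V) (hΓ : Γ.BelowConjThree), ∀ ω ∈ R.Theta V c i Γ,
          ∃ cf : towerLevel hHD hI (ballQuotientUniformisedDatum_of h₁) h₃ hA Γ hΓ,
            TowerLevel.res hHD hI (ballQuotientUniformisedDatum_of h₁) h₃ hA cf = ω ∧
              (ofLevel hHD hI (ballQuotientUniformisedDatum_of h₁) h₃ hA Γ hΓ cf :
                  (LiuDictionary.ofTower hHD hI h₁ h₃ hA V (Char V) (Adm V) (Ω V) (PhiMu V) (adm V)).H) ∈
                ⨆ μ ∈ S, (LiuDictionary.ofTower hHD hI h₁ h₃ hA V (Char V) (Adm V) (Ω V) (PhiMu V) (adm V)).block μ) :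
    ∀ {L : CMField} {ι₁ : L →+* ℂ} (V : HermSpace3 L ι₁) (c : SeesawCtx L), P V c → R.GoodCtx ι₁ c →
      Module.finrank ℚ c.K = 6 → ∀ i : Fin 4, ∃ Γ₀ : Level V, ∀ Γ ≤ Γ₀,
        R.Theta V c i Γ ⊆
          Submodule.span ℂ (⋃ D : CommonReflexInput c.K (c.Ψ i) c.σ, D.surfaceClasses hHD hI h₁ h₃ V Γ) := by
  intro L ι₁ V c hP hgood h6 i
  obtain ⟨S, hΦ, hcorner, hfam⟩ := hJ V c hP hgood h6 i
  obtain ⟨hirr, h413, h4182, hμ, h418⟩ := hcite V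
  exact subset_span_of_tower hA (Char V) (Adm V) (Ω V) (PhiMu V) (adm V) hirr h413 h4182 hμ h418 S hΦ hcorner
    (fun Γ ↦ R.Theta V c i Γ) hfam

/-- **E's `hsmall` THROUGH THE TOWER** (scoped by `P`): by binder-1's landed `hsmall_of_commonReflexUnion_of` (Riemann's fullness `hR`). -/
theorem hsmall_of_tower (hR : DeligneMilne1982_Thm_6_20_full) (hA : Arapura2012_Cor_15_4_6)
    (R : (picardCMUniverse hHD hI h₁ h₃).ThetaModel)
    (Char : ∀ {L : CMField} {ι₁ : L →+* ℂ}, HermSpace3 L ι₁ → Type)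
    (Adm : ∀ {L : CMField} {ι₁ : L →+* ℂ} (V : HermSpace3 L ι₁), Char V → Type)
    (Ω : ∀ {L : CMField} {ι₁ : L →+* ℂ} (V : HermSpace3 L ι₁) (μ : Char V), Adm V μ → Type)
    [∀ {L : CMField} {ι₁ : L →+* ℂ} (V : HermSpace3 L ι₁) (μ : Char V) (a : Adm V μ), AddCommGroup (Ω V μ a)]
    [∀ {L : CMField} {ι₁ : L →+* ℂ} (V : HermSpace3 L ι₁) (μ : Char V) (a : Adm V μ), Module ℂ (Ω V μ a)]
    [∀ {L : CMField} {ι₁ : L →+* ℂ} (V : HermSpace3 L ι₁) (μ : Char V) (a : Adm V μ), Module (adelicAlgebra V) (Ω V μ a)]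
    [∀ {L : CMField} {ι₁ : L →+* ℂ} (V : HermSpace3 L ι₁) (μ : Char V) (a : Adm V μ), IsScalarTower ℂ (adelicAlgebra V) (Ω V μ a)]
    (PhiMu : ∀ {L : CMField} {ι₁ : L →+* ℂ} (V : HermSpace3 L ι₁), Char V → Prop)
    (adm : ∀ {L : CMField} {ι₁ : L →+* ℂ} (V : HermSpace3 L ι₁), Char V → LiuCMSide → Prop)
    (hcite : ∀ {L : CMField} {ι₁ : L →+* ℂ} (V : HermSpace3 L ι₁),
      (LiuDictionary.ofTower hHD hI h₁ h₃ hA V (Char V) (Adm V) (Ω V) (PhiMu V) (adm V)).Irreducible ∧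
      (LiuDictionary.ofTower hHD hI h₁ h₃ hA V (Char V) (Adm V) (Ω V) (PhiMu V) (adm V)).Prop413 ∧
      (LiuDictionary.ofTower hHD hI h₁ h₃ hA V (Char V) (Adm V) (Ω V) (PhiMu V) (adm V)).Thm418_2 ∧
      (LiuDictionary.ofTower hHD hI h₁ h₃ hA V (Char V) (Adm V) (Ω V) (PhiMu V) (adm V)).MuSeparated ∧
      (LiuDictionary.ofTower hHD hI h₁ h₃ hA V (Char V) (Adm V) (Ω V) (PhiMu V) (adm V)).Thm418C)
    (P : ∀ {L : CMField} {ι₁ : L →+* ℂ}, HermSpace3 L ι₁ → SeesawCtx L → Prop)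
    (hJ : ∀ {L : CMField} {ι₁ : L →+* ℂ} (V : HermSpace3 L ι₁) (c : SeesawCtx L), P V c → R.GoodCtx ι₁ c →
      Module.finrank ℚ c.K = 6 → ∀ i : Fin 4, ∃ S : Finset (Char V),
        (∀ μ ∈ S, PhiMu V μ) ∧
        (∀ μ ∈ S, ∀ d : LiuCMSide, adm V μ d → d.IsCorner c.K (c.Ψ i) c.σ) ∧
        ∀ (Γ : Level V) (hΓ : Γ.BelowConjThree), ∀ ω ∈ R.Theta V c i Γ,
          ∃ cf : towerLevel hHD hI (ballQuotientUniformisedDatum_of h₁) h₃ hA Γ hΓ,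
            TowerLevel.res hHD hI (ballQuotientUniformisedDatum_of h₁) h₃ hA cf = ω ∧
              (ofLevel hHD hI (ballQuotientUniformisedDatum_of h₁) h₃ hA Γ hΓ cf :
                  (LiuDictionary.ofTower hHD hI h₁ h₃ hA V (Char V) (Adm V) (Ω V) (PhiMu V) (adm V)).H) ∈
                ⨆ μ ∈ S, (LiuDictionary.ofTower hHD hI h₁ h₃ hA V (Char V) (Adm V) (Ω V) (PhiMu V) (adm V)).block μ) :
    ∀ {L : CMField} {ι₁ : L →+* ℂ} (V : HermSpace3 L ι₁) (c : SeesawCtx L), P V c → R.GoodCtx ι₁ c →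
      Module.finrank ℚ c.K = 6 → ∀ i : Fin 4, ∃ Γ₀ : Level V, ∀ Γ ≤ Γ₀,
        ∃ (M : CMField) (k : c.K →+* M) (σ' : M →+* ℂ), σ'.comp k = c.σ ∧
          R.Theta V c i Γ ⊆ (picardCMUniverse hHD hI h₁ h₃).Uiso Γ M (inflate k (c.Ψ i)) σ' :=
  hsmall_of_commonReflexUnion_of hHD hI h₁ h₃ hR R P (hThetaUnion_of_tower hA R Char Adm Ω PhiMu adm hcite P hJ)

end HodgeCM.Model

end
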